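import Literature.Computability.Cryptography.InaccessibleEntropyUOWHFInverterBricks
import Literature.Computability.Cryptography.InaccessibleEntropyUOWHFInstance
import Mathlib.GroupTheory.Index
import HarnessLib

/-!
# One-way functions ⇒ UOWHF, machine layer VIII: the key fix-up samples the conditioned hash key uniformly

Topic `Literature/Computability/Cryptography`; sixteenth file of the "one-way functions ⇒ universal one-way
hash functions" line (Haitner–Holenstein–Reingold–Vadhan–Wee 2020). The inverter of Claim 4.6 must choose the
hash key `g` "uniformly subject to `g(y)_{1…i} = g(f(x))_{1…i}`" (the set `plantKeys` of
`InaccessibleEntropyPrefixHash.lean`). For the affine family keyed by strings (row `q` = matrix bits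
`q(n+1) … q(n+1)+n−1`, offset bit `q(n+1)+n`) the condition says that the first `i` rows are orthogonal to
`δ = y ⊕ f(x)`, and the machine (`fixupStr`, `InaccessibleEntropyUOWHFInverterBricks.lean`) realises the
conditioning by a deterministic FIX-UP of a uniform key: flip the bit of row `q < i` at the pivot of `δ`
whenever `⟨row_q, δ⟩ = 1`. This file proves that this is correct and uniform:

* `KeyZ n = 𝔽₂^{ℓK}`, `par δz q` (the linear functional `⟨row_q, δ⟩`), `corr` (the linear correction), the
  fix-up `fixHom = id + corr` as an additive homomorphism, `range_fixHom` (= the keys with `par_q = 0` for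
  `q < i`, when `δ_p = 1`), and — by `AddMonoidHom.card_fiber_eq_of_mem_range` — **`sum_fixHom_eq`**: summing a
  function over fixed-up uniform keys is a constant multiple of summing it over the good keys;
* `fixupStr_eq_enc` — the string fix-up IS `fixHom` on codes; `mem_plantKeys_iff_par` — for the instance
  `cand n j f`, `plantKeys` IS the set of good keys (`δ = f x₀ ⊕ f x`);
* **`card_mul_sum_fixup`** — the form used by the inverter analysis: for every `g ≥ 0`,
  `|plantKeys| · Σ_{κ₀} g(fixup κ₀) = |𝒦| · Σ_{κ ∈ plantKeys} g(κ)`.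

All statements proved; no named facts.

## References

* I. Haitner, T. Holenstein, O. Reingold, S. Vadhan, H. Wee, *Inaccessible Entropy II: IE Functions and
  Universal One-Way Hashing*, Theory of Computing 16(8) (2020), Claim 4.6 (the inverter `Inv`).
* O. Goldreich, *Foundations of Cryptography II*, CUP 2004, §6.4.3.2, proof of Prop. 6.4.21 (conditioning the
  hashing function on the challenge, "uniformly among those satisfying …").
* S. Arora, B. Barak, *Computational Complexity*, CUP 2009, Def. 8.14 / Exercise 8.4 (the affine family).
-/

namespace Literature.Computability.Cryptography

namespace HHRVW

open _root_.Computability Complexity Complexity.BitCodec AffineStr Sz Finset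
open Complexity.Stockmeyer (bz bz_injective bz_and bz_xor bz_decide_odd bz_true bz_false coinBit rowStart coinHash)

/-! ### The fix-up over `𝔽₂` -/

section Linear

variable (n : ℕ)

/-- Keys of the row hash as `𝔽₂`-vectors. [folklore] -/
abbrev KeyZ := Fin (lK n) → ZMod 2

/-- Coordinate `m` of a key (zero beyond `ℓK`). [folklore] -/
def gp (κ : KeyZ n) (m : ℕ) : ZMod 2 := if h : m < lK n then κ ⟨m, h⟩ else 0

/-- `gp` is additive. [folklore] -/
theorem gp_add (κ κ' : KeyZ n) (m : ℕ) : gp n (κ + κ') m = gp n κ m + gp n κ' m := by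
  unfold gp; split_ifs <;> simp

variable (δz : Fin n → ZMod 2) (i p : ℕ)

/-- **The parity** `par_q(κ) = ⟨row_q, δ⟩ = Σ_c κ_{q(n+1)+c} δ_c`. [cite: HaitnerEtAl2020, Claim 4.6] -/
def par (q : ℕ) (κ : KeyZ n) : ZMod 2 := ∑ c : Fin n, gp n κ (q * (n + 1) + c) * δz c

/-- `par_q` is additive. [folklore] -/
theorem par_add (q : ℕ) (κ κ' : KeyZ n) : par n δz q (κ + κ') = par n δz q κ + par n δz q κ' := by
  simp only [par, gp_add, add_mul, sum_add_distrib]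

/-- **The correction**: `par_q(κ)` placed at the pivot bit `q(n+1)+p` of every row `q < i`.
[cite: HaitnerEtAl2020, Claim 4.6] -/
def corrFun (κ : KeyZ n) : KeyZ n := fun m => ∑ q ∈ range i, if (m : ℕ) = q * (n + 1) + p then par n δz q κ else 0

/-- The correction as an additive homomorphism. [folklore] -/
def corr : KeyZ n →+ KeyZ n where
  toFun := corrFun n δz i p
  map_zero' := by funext m; simp [corrFun, par, gp]
  map_add' κ κ' := by
    funext m
    simp only [corrFun, Pi.add_apply, ← sum_add_distrib]
    refine sum_congr rfl fun q _ => ?_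
    split_ifs <;> simp [par_add]

/-- **The fix-up** `φ = id + corr`. [cite: HaitnerEtAl2020, Claim 4.6] -/
def fixHom : KeyZ n →+ KeyZ n := AddMonoidHom.id _ + corr n δz i p

/-- Value of the fix-up. [folklore] -/
theorem fixHom_apply (κ : KeyZ n) : fixHom n δz i p κ = κ + corrFun n δz i p κ := rfl

variable {n δz i p}

/-- Positions `q(n+1)+c` with `c ≤ n` determine `(q, c)`. [folklore] -/
theorem pos_inj {q c q' c' : ℕ} (hc : c ≤ n) (hc' : c' ≤ n) (h : q * (n + 1) + c = q' * (n + 1) + c') : q = q' ∧ c = c' := by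
  have h1 : (q * (n + 1) + c) / (n + 1) = q := by
    rw [Nat.add_comm, Nat.add_mul_div_right _ _ (Nat.succ_pos n), Nat.div_eq_of_lt (by omega), Nat.zero_add]
  have h2 : (q' * (n + 1) + c') / (n + 1) = q' := by
    rw [Nat.add_comm, Nat.add_mul_div_right _ _ (Nat.succ_pos n), Nat.div_eq_of_lt (by omega), Nat.zero_add]
  have hq : q = q' := by rw [← h1, h, h2]
  subst hq
  exact ⟨rfl, by omega⟩

/-- Coordinates of the correction: at `q(n+1)+c` (`c ≤ n`) it is `[q < i][c = p] · par_q`. [folklore] -/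
theorem gp_corrFun (hp : p ≤ n) (κ : KeyZ n) {q c : ℕ} (hc : c ≤ n) (hm : q * (n + 1) + c < lK n) :
    gp n (corrFun n δz i p κ) (q * (n + 1) + c) = if q < i ∧ c = p then par n δz q κ else 0 := by
  rw [gp, dif_pos hm, corrFun]
  simp only
  by_cases h : q < i ∧ c = p
  · rw [if_pos h, sum_eq_single_of_mem q (mem_range.2 h.1)]
    · rw [if_pos (by rw [h.2])]
    · intro q' _ hne
      rw [if_neg]
      intro heq
      exact hne (pos_inj hc hp heq).1.symm
  · rw [if_neg h]
    refine sum_eq_zero fun q' hq' => ?_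
    rw [if_neg]
    intro heq
    obtain ⟨rfl, rfl⟩ := pos_inj hc hp heq
    exact h ⟨mem_range.1 hq', rfl⟩

/-- Coordinates of the correction beyond `ℓK` vanish (trivially, as all coordinates there). [folklore] -/
theorem gp_of_le {κ : KeyZ n} {m : ℕ} (hm : lK n ≤ m) : gp n κ m = 0 := by rw [gp, dif_neg (by omega)]

/-- **The parity of a corrected key**: `par_q(corr κ) = [q < i] · par_q(κ) · δ_p` (`p < n`). [folklore] -/
theorem par_corrFun (hp : p < n) (κ : KeyZ n) (q : ℕ) :
    par n δz q (corrFun n δz i p κ) = if q < i then par n δz q κ * δz ⟨p, hp⟩ else 0 := by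
  by_cases hqM : q < M n
  · -- a genuine row: all its positions are inside the key
    have hin : ∀ c, c ≤ n → q * (n + 1) + c < lK n := fun c hc => by
      have := Nat.mul_le_mul_right (n + 1) hqM; rw [Nat.succ_mul, lK] at *; omega
    rw [par, sum_eq_single_of_mem (⟨p, hp⟩ : Fin n) (mem_univ _)]
    · rw [gp_corrFun hp.le κ hp.le (hin p hp.le)]
      by_cases hqi : q < i <;> simp [hqi]
    · intro c _ hc
      rw [gp_corrFun hp.le κ (Nat.le_of_lt c.isLt) (hin c c.isLt.le), if_neg, zero_mul]
      rintro ⟨_, h⟩; exact hc (Fin.ext h)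
  · -- beyond the key every coordinate of the row vanishes
    push Not at hqM
    have hout : ∀ c : Fin n, lK n ≤ q * (n + 1) + c := fun c => by
      have := Nat.mul_le_mul_right (n + 1) hqM; rw [lK]; omega
    have hz : ∀ κ' : KeyZ n, par n δz q κ' = 0 := fun κ' => sum_eq_zero fun c _ => by rw [gp_of_le (hout c), zero_mul]
    rw [hz, hz]; split_ifs <;> simp

/-- **The fix-up lands in the good keys**: `par_q(φ κ) = 0` for `q < i`, when `δ_p = 1`. [cite: HaitnerEtAl2020, Claim 4.6] -/
theorem par_fixHom (hp : p < n) (hδ : δz ⟨p, hp⟩ = 1) (κ : KeyZ n) {q : ℕ} (hq : q < i) : par n δz q (fixHom n δz i p κ) = 0 := by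
  rw [fixHom_apply, par_add, par_corrFun hp, if_pos hq, hδ, mul_one, CharTwo.add_self_eq_zero]

/-- **Good keys are fixed**: if `par_q(κ) = 0` for all `q < i` then `φ κ = κ`. [cite: HaitnerEtAl2020, Claim 4.6] -/
theorem fixHom_of_good (κ : KeyZ n) (h : ∀ q, q < i → par n δz q κ = 0) : fixHom n δz i p κ = κ := by
  rw [fixHom_apply]
  have : corrFun n δz i p κ = 0 := by
    funext m
    rw [corrFun, Pi.zero_apply]
    exact sum_eq_zero fun q hq => by rw [h q (mem_range.1 hq)]; simp
  rw [this, add_zero]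

/-- The good keys. [cite: HaitnerEtAl2020, Claim 4.6 (the condition `g(y)_{<i} = g(f x)_{<i}`)] -/
def Good (n : ℕ) (δz : Fin n → ZMod 2) (i : ℕ) : Finset (KeyZ n) := univ.filter fun κ => ∀ q, q < i → par n δz q κ = 0

/-- **The range of the fix-up is the set of good keys** (`δ_p = 1`). [cite: HaitnerEtAl2020, Claim 4.6] -/
theorem mem_range_fixHom_iff (hp : p < n) (hδ : δz ⟨p, hp⟩ = 1) (κ : KeyZ n) :
    κ ∈ Set.range (fixHom n δz i p) ↔ κ ∈ Good n δz i := by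
  rw [Good, mem_filter]
  constructor
  · rintro ⟨κ₀, rfl⟩
    exact ⟨mem_univ _, fun q hq => par_fixHom hp hδ κ₀ hq⟩
  · rintro ⟨_, h⟩
    exact ⟨κ, fixHom_of_good κ h⟩

/-- **Uniformity of the fix-up** (all fibres over the range of a homomorphism are equal): for `g ≥ 0` … indeed
for every real `g`, `|Good| · Σ_{κ₀} g(φ κ₀) = |𝔽₂^{ℓK}| · Σ_{κ ∈ Good} g(κ)`. [cite: HaitnerEtAl2020, Claim 4.6 ("uniformly")] -/
theorem card_mul_sum_fixHom (hp : p < n) (hδ : δz ⟨p, hp⟩ = 1) (g : KeyZ n → ℝ) :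
    ((Good n δz i).card : ℝ) * ∑ κ₀ : KeyZ n, g (fixHom n δz i p κ₀) =
      (Fintype.card (KeyZ n) : ℝ) * ∑ κ ∈ Good n δz i, g κ := by
  classical
  set φ := fixHom n δz i p with hφ
  -- the common fibre size
  have h0 : (0 : KeyZ n) ∈ Set.range φ := ⟨0, map_zero φ⟩
  set F := (univ.filter fun κ₀ : KeyZ n => φ κ₀ = 0).card with hF
  have hfib : ∀ κ ∈ Good n δz i, (univ.filter fun κ₀ : KeyZ n => φ κ₀ = κ).card = F := fun κ hκ =>
    AddMonoidHom.card_fiber_eq_of_mem_range φ ((mem_range_fixHom_iff hp hδ κ).2 hκ) h0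
  -- decompose both sums along the fibres
  have hsum : ∑ κ₀ : KeyZ n, g (φ κ₀) = ∑ κ ∈ Good n δz i, (F : ℝ) * g κ := by
    rw [← sum_fiberwise_of_maps_to (s := (univ : Finset (KeyZ n))) (t := Good n δz i) (g := φ)
      (fun κ₀ _ => (mem_range_fixHom_iff hp hδ _).1 ⟨κ₀, rfl⟩)]
    refine sum_congr rfl fun κ hκ => ?_
    rw [sum_congr rfl fun κ₀ hκ₀ => by rw [(mem_filter.1 hκ₀).2], sum_const, hfib κ hκ, nsmul_eq_mul]
  have hcard : (Fintype.card (KeyZ n) : ℝ) = ∑ κ ∈ Good n δz i, (F : ℝ) := by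
    have := card_eq_sum_card_fiberwise (s := (univ : Finset (KeyZ n))) (t := Good n δz i) (f := φ)
      (fun κ₀ _ => (mem_range_fixHom_iff hp hδ _).1 ⟨κ₀, rfl⟩)
    rw [card_univ] at this
    rw [this, Nat.cast_sum]
    exact sum_congr rfl fun κ hκ => by rw [hfib κ hκ]
  rw [hsum, hcard, ← mul_sum, sum_const, nsmul_eq_mul]
  ring

end Linear

/-! ### The string fix-up is the linear fix-up on codes -/

section Strings

variable {n : ℕ}

/-- The difference vector of a string `δ`. [folklore] -/
def dz (n : ℕ) (δ : List Bool) : Fin n → ZMod 2 := fun c => bz (δ.getD c false)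

/-- The key vector of a key string. [folklore] -/
def kz (n : ℕ) (σ : List Bool) : KeyZ n := (zvec (lK n)).dec σ

/-- Coordinates of the key vector are the bits. [folklore] -/
theorem gp_kz (σ : List Bool) (m : ℕ) (hm : m < lK n) : gp n (kz n σ) m = bz (σ.getD m false) := by
  rw [gp, dif_pos hm]; rfl

/-- **The machine's row parity is `par`.** [folklore] -/
theorem bz_rowPar {σ δ : List Bool} (hδ : δ.length = n) {q : ℕ} (hq : q < M n) :
    bz (rowPar n σ δ q) = par n (dz n δ) q (kz n σ) := by
  rw [rowPar, bz_decide_odd, Stockmeyer.count_zipWith_and, Nat.count_eq_card_filter_range, hδ, par]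
  have hrow : ∀ c : Fin n, (rowStr n σ q).getD c false = σ.getD (q * (n + 1) + c) false := fun c => by
    rw [rowStr, List.getD_eq_getElem?_getD, List.getD_eq_getElem?_getD, List.getElem?_take, if_pos (by omega),
      List.getElem?_drop]
  have hpos : ∀ c : Fin n, q * (n + 1) + c < lK n := fun c => by
    have := Nat.mul_le_mul_right (n + 1) hq; rw [Nat.succ_mul, lK] at *; omega
  rw [sum_congr rfl fun c _ => by rw [gp_kz _ _ (hpos c), dz, ← bz_and, ← hrow c],
    Fin.sum_univ_eq_sum_range (fun c : ℕ => bz ((rowStr n σ q).getD c false && δ.getD c false)) n]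
  simp [bz, sum_boole]

/-- Bits of a `ccat` of `(n+1)`-blocks. [folklore] -/
theorem getD_ccat_block {g : ℕ → List Bool} {k : ℕ} (h : ∀ q, q < k → (g q).length = n + 1) {q c : ℕ} (hq : q < k) (hc : c ≤ n) :
    (ccat g k).getD (q * (n + 1) + c) false = (g q).getD c false := by
  have hb := ccat_block h hq
  have := congrArg (fun l => l.getD c false) hb
  simp only [List.getD_eq_getElem?_getD, List.getElem?_take, if_pos (show c < n + 1 by omega), List.getElem?_drop] at this
  simpa [List.getD_eq_getElem?_getD] using this

/-- Bits of a fixed-up row. [folklore] -/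
theorem getD_fixRow {σ δ : List Bool} {i q c : ℕ} (hrow : (rowStr n σ q).length = n + 1) (hp : lzStr δ ≤ n) (hc : c ≤ n) :
    (fixRow n σ δ i q).getD c false = xor ((rowStr n σ q).getD c false) (decide (q < i) && rowPar n σ δ q && decide (c = lzStr δ)) := by
  rw [fixRow]
  by_cases h : q < i ∧ rowPar n σ δ q = true
  · rw [if_pos h]
    simp only [h.1, h.2, decide_true, Bool.true_and]
    rw [List.getD_eq_getElem?_getD, List.getD_eq_getElem?_getD]
    rcases lt_trichotomy c (lzStr δ) with hlt | rfl | hgt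
    · rw [List.getElem?_append_left (by rw [List.length_append, List.length_take, List.length_singleton]; omega),
        List.getElem?_append_left (by rw [List.length_take]; omega), List.getElem?_take, if_pos hlt]
      simp [hlt.ne]
    · rw [List.getElem?_append_left (by rw [List.length_append, List.length_take, List.length_singleton]; omega),
        List.getElem?_append_right (by rw [List.length_take]; omega)]
      simp only [List.length_take, min_eq_left (show lzStr δ ≤ (rowStr n σ q).length by omega), Nat.sub_self,
        List.getElem?_cons_zero, Option.getD_some, decide_true, Bool.xor_true, List.getD_eq_getElem?_getD]
    · rw [List.getElem?_append_right (by rw [List.length_append, List.length_take, List.length_singleton]; omega)]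
      simp only [List.length_append, List.length_take, List.length_singleton, min_eq_left (show lzStr δ ≤ (rowStr n σ q).length by omega),
        List.getElem?_drop]
      rw [show lzStr δ + 1 + (c - (lzStr δ + 1)) = c by omega]
      simp [hgt.ne']
  · rw [if_neg h]
    have : (decide (q < i) && rowPar n σ δ q) = false := by
      rcases not_and_or.1 h with h1 | h1
      · simp [h1]
      · simp [Bool.eq_false_iff.2 h1]
    rw [this, Bool.false_and, Bool.xor_false]

/-- Bits of `encZ` through `getD`. [folklore] -/
theorem getD_encZ {k : ℕ} (v : Fin k → ZMod 2) (m : ℕ) :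
    (encZ k v).getD m false = if h : m < k then decide (v ⟨m, h⟩ = 1) else false := by
  rw [List.getD_eq_getElem?_getD]
  by_cases h : m < k
  · rw [List.getElem?_eq_getElem (by rw [length_encZ]; exact h), Option.getD_some, getElem_encZ, dif_pos h]
  · rw [List.getElem?_eq_none (by rw [length_encZ]; omega), Option.getD_none, dif_neg h]

/-- **The string fix-up is the linear fix-up on the code** of a full key. [cite: HaitnerEtAl2020, Claim 4.6] -/
theorem fixupStr_eq_enc {σ δ : List Bool} (hσ : σ.length = lK n) (hδ : δ.length = n) (hp : lzStr δ < n) (i : ℕ) :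
    fixupStr n σ δ i = (zvec (lK n)).enc (fixHom n (dz n δ) i (lzStr δ) (kz n σ)) := by
  have hrow : ∀ q, q < M n → (rowStr n σ q).length = n + 1 := fun q hq => by
    rw [rowStr, List.length_take, List.length_drop, hσ, lK, min_eq_left]
    have := Nat.mul_le_mul_right (n + 1) hq; rw [Nat.succ_mul] at this; omega
  have hlen : (fixupStr n σ δ i).length = lK n := by
    rw [fixupStr, lK, length_ccat_blocks (m := n + 1) fun q hq => by rw [length_fixRow (by rw [hrow q hq]; omega), hrow q hq]]
  apply List.ext_getElem (by rw [hlen, (zvec (lK n)).length_enc]; rfl)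
  intro m h1 h2
  rw [hlen] at h1
  -- `m = q (n+1) + c`
  obtain ⟨q, c, hc, rfl⟩ : ∃ q c, c ≤ n ∧ m = q * (n + 1) + c :=
    ⟨m / (n + 1), m % (n + 1), Nat.le_of_lt_succ (Nat.mod_lt _ (Nat.succ_pos n)), by rw [Nat.div_add_mod']⟩
  have hq : q < M n := by
    by_contra hh; push Not at hh
    have := Nat.mul_le_mul_right (n + 1) hh; rw [lK] at h1; omega
  -- both sides through `getD`
  have hl : (fixupStr n σ δ i)[q * (n + 1) + c] = ((fixupStr n σ δ i).getD (q * (n + 1) + c) false) := by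
    rw [List.getD_eq_getElem?_getD, List.getElem?_eq_getElem (by rw [hlen]; exact h1), Option.getD_some]
  have hr : ((zvec (lK n)).enc (fixHom n (dz n δ) i (lzStr δ) (kz n σ)))[q * (n + 1) + c] =
      ((zvec (lK n)).enc (fixHom n (dz n δ) i (lzStr δ) (kz n σ))).getD (q * (n + 1) + c) false := by
    rw [List.getD_eq_getElem?_getD, List.getElem?_eq_getElem h2, Option.getD_some]
  have hσm : (rowStr n σ q).getD c false = σ.getD (q * (n + 1) + c) false := by
    rw [rowStr, List.getD_eq_getElem?_getD, List.getD_eq_getElem?_getD, List.getElem?_take, if_pos (by omega), List.getElem?_drop]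
  have hk : (kz n σ) ⟨q * (n + 1) + c, h1⟩ = bz (σ.getD (q * (n + 1) + c) false) := rfl
  have hcorr : corrFun n (dz n δ) i (lzStr δ) (kz n σ) ⟨q * (n + 1) + c, h1⟩ =
      if q < i ∧ c = lzStr δ then bz (rowPar n σ δ q) else 0 := by
    have := gp_corrFun (δz := dz n δ) (i := i) hp.le (kz n σ) hc h1
    rwa [gp, dif_pos h1, ← bz_rowPar hδ hq] at this
  rw [hl, hr, fixupStr, getD_ccat_block (fun q hq => by rw [length_fixRow (by rw [hrow q hq]; omega), hrow q hq]) hq hc,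
    getD_fixRow (hrow q hq) hp.le hc, zvec_enc, getD_encZ, dif_pos h1, fixHom_apply, hσm]
  simp only [Pi.add_apply, hk, hcorr]
  -- a finite check on booleans
  generalize σ.getD (q * (n + 1) + c) false = b
  generalize rowPar n σ δ q = r
  by_cases hqi : q < i <;> by_cases hcp : c = lzStr δ <;> cases b <;> cases r <;> simp [hqi, hcp]

/-- The pivot is a `1` of `δ` (when `δ` has one). [folklore] -/
theorem getD_lzStr {δ : List Bool} (hp : lzStr δ < δ.length) : δ.getD (lzStr δ) false = true := by
  -- `δ ⊕ 1^{|δ|}` starts with `lz δ` ones followed by a zero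
  have key : ∀ (w : List Bool), (splitOnes w).1 < w.length → w.getD (splitOnes w).1 false = false := by
    intro w
    induction w with
    | nil => intro h; simp at h
    | cons b w ih =>
      intro h
      cases b
      · rfl
      · simp only [splitOnes] at h ⊢
        rw [List.getD_cons_succ]
        exact ih (by simpa using h)
  have h1 : (List.zipWith xor δ (ones δ.length)).length = δ.length := by simp [ones]
  have h2 := key (List.zipWith xor δ (ones δ.length)) (by rw [h1]; exact hp)
  rw [← lzStr] at h2
  rw [List.getD_eq_getElem?_getD, List.getElem?_zipWith] at h2
  rw [List.getD_eq_getElem?_getD]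
  cases hδ : δ[lzStr δ]? with
  | none => rw [List.getElem?_eq_none_iff] at hδ; omega
  | some b =>
    rw [hδ] at h2
    simp only [ones, List.getElem?_replicate, if_pos hp] at h2
    cases b <;> simp_all

/-- No `1` before the pivot… not needed; instead: **if the pivot is `|δ|` then `δ = 0…0`**, so all parities vanish.
[folklore] -/
theorem dz_eq_zero_of_lzStr {δ : List Bool} (hδ : δ.length = n) (hp : n ≤ lzStr δ) : dz n δ = 0 := by
  have key : ∀ (w : List Bool) (c : ℕ), c < (splitOnes w).1 → w.getD c false = true := by
    intro w
    induction w with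
    | nil => intro c h; simp [splitOnes] at h
    | cons b w ih =>
      intro c h
      cases b
      · simp [splitOnes] at h
      · cases c with
        | zero => rfl
        | succ c => rw [List.getD_cons_succ]; exact ih c (by simpa [splitOnes] using h)
  funext c
  rw [dz, Pi.zero_apply]
  have h2 := key (List.zipWith xor δ (ones δ.length)) c (by rw [← lzStr]; have := c.isLt; omega)
  rw [List.getD_eq_getElem?_getD, List.getElem?_zipWith] at h2
  rw [List.getD_eq_getElem?_getD]
  cases hc : δ[(c : ℕ)]? with
  | none => rfl
  | some b =>
    rw [hc] at h2
    have hcl : (c : ℕ) < δ.length := by rw [hδ]; exact c.isLt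
    simp only [ones, List.getElem?_replicate, if_pos hcl] at h2
    cases b <;> simp_all

/-- With `δ = 0…0` every parity vanishes and the string fix-up is the identity. [folklore] -/
theorem fixupStr_eq_self {σ δ : List Bool} (hσ : σ.length = lK n) (hδ : δ.length = n) (hp : n ≤ lzStr δ) (i : ℕ) :
    fixupStr n σ δ i = σ := by
  have hz := dz_eq_zero_of_lzStr hδ hp
  have hrow : ∀ q, q < M n → (rowStr n σ q).length = n + 1 := fun q hq => by
    rw [rowStr, List.length_take, List.length_drop, hσ, lK, min_eq_left]
    have := Nat.mul_le_mul_right (n + 1) hq; rw [Nat.succ_mul] at this; omega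
  have hpar : ∀ q, q < M n → rowPar n σ δ q = false := fun q hq => by
    have h := bz_rowPar (σ := σ) hδ hq
    rw [hz] at h
    have : par n (0 : Fin n → ZMod 2) q (kz n σ) = 0 := by simp [par]
    rw [this] at h
    cases hr : rowPar n σ δ q
    · rfl
    · rw [hr, bz_true] at h; exact absurd h one_ne_zero
  rw [fixupStr]
  conv_rhs => rw [← ccat_of_blocks (m := n + 1) (k := M n) (w := σ) (by rw [hσ, lK])]
  refine ccat_congr fun q hq => ?_
  rw [fixRow, if_neg (by rw [hpar q hq]; simp), rowStr]

/-- `|fixupStr| = ℓK` for a full key and `|δ| = n`. [folklore] -/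
theorem length_fixupStr {σ δ : List Bool} (hσ : σ.length = lK n) (hδ : δ.length = n) (i : ℕ) : (fixupStr n σ δ i).length = lK n := by
  have hrow : ∀ q, q < M n → (rowStr n σ q).length = n + 1 := fun q hq => by
    rw [rowStr, List.length_take, List.length_drop, hσ, lK, min_eq_left]
    have := Nat.mul_le_mul_right (n + 1) hq; rw [Nat.succ_mul] at this; omega
  have hp : lzStr δ ≤ n := by have := lzStr_le δ; rwa [hδ] at this
  rw [fixupStr, lK, length_ccat_blocks (m := n + 1) fun q hq => by rw [length_fixRow (by rw [hrow q hq]; omega), hrow q hq]]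

end Strings

/-! ### The instance: `plantKeys` is the set of good keys, and the counting identity -/

section Instance

variable {n j : ℕ} {f : List Bool → List Bool}

/-- **The affine hash by rows**: `(h_σ(v))_q = Σ_c σ_{q(n+1)+c} v_c + σ_{q(n+1)+n}`.
[cite: AroraBarakCC2009, Def. 8.14 (p. 185) with Exercise 8.4 (p. 204)] -/
theorem hashV_apply_row (σ : List Bool) (v : List.Vector Bool n) (q : Fin (M n)) :
    hashV n (M n) σ v q = (∑ c : Fin n, bz (σ.getD (q * (n + 1) + c) false) * bz (v.get c)) + bz (σ.getD (q * (n + 1) + n) false) := by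
  simp [hashV, AffineHash.hash, coinHash, Matrix.mulVec, dotProduct, Stockmeyer.toZ, rowStart, coinBit]

/-- **`plantKeys` of the instance is the set of good keys** for `δ = f x₀ ⊕ f x` (length-preserving `f`).
[cite: HaitnerEtAl2020, Claim 4.6] -/
theorem mem_plantKeys_iff_par (hf : IsLengthPreserving f) (x₀ x : Xv n) (i : ℕ) (κ : Kv n) :
    κ ∈ plantKeys (cand n j f).f (cand n j f).hp x₀ x i ↔
      ∀ q, q < i → par n (dz n (List.zipWith xor (f x₀.toList) (f x.toList))) q (kz n κ.toList) = 0 := by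
  have hx₀ : (f x₀.toList).length = n := by rw [hf, List.Vector.toList_length]
  have hx : (f x.toList).length = n := by rw [hf, List.Vector.toList_length]
  rw [mem_plantKeys]
  show affinePrefix n (M n) (lK n) (padV n) κ i (f x₀.toList) = affinePrefix n (M n) (lK n) (padV n) κ i (f x.toList) ↔ _
  rw [affinePrefix, affinePrefix, prefixZ_eq_iff]
  -- row `q` of the condition
  have hrow : ∀ q : Fin (M n), hashV n (M n) κ.toList (padV n (f x₀.toList)) q = hashV n (M n) κ.toList (padV n (f x.toList)) q ↔
      par n (dz n (List.zipWith xor (f x₀.toList) (f x.toList))) q (kz n κ.toList) = 0 := by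
    intro q
    rw [hashV_apply_row, hashV_apply_row, add_left_inj, ← sub_eq_zero, ← sum_sub_distrib, par]
    have hget : ∀ (y : List Bool) (hy : y.length = n) (c : Fin n), (padV n y).get c = y.getD c false := by
      intro y hy c
      rw [Stockmeyer.get_eq_getD]
      congr 1
      exact vector_dec_toList n hy
    have hpos : ∀ c : Fin n, (q : ℕ) * (n + 1) + c < lK n := fun c => by
      have := Nat.mul_le_mul_right (n + 1) q.isLt; rw [Nat.succ_mul, lK] at *; omega
    have hdz : ∀ c : Fin n, bz ((padV n (f x₀.toList)).get c) - bz ((padV n (f x.toList)).get c) =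
        dz n (List.zipWith xor (f x₀.toList) (f x.toList)) c := fun c => by
      rw [hget _ hx₀, hget _ hx, dz]
      simp only [List.getD_eq_getElem?_getD, List.getElem?_zipWith, List.getElem?_eq_getElem (show (c : ℕ) < (f x₀.toList).length by rw [hx₀]; exact c.isLt),
        List.getElem?_eq_getElem (show (c : ℕ) < (f x.toList).length by rw [hx]; exact c.isLt), Option.getD_some,
        bz_xor, CharTwo.sub_eq_add]
    refine Eq.congr_left (sum_congr rfl fun c _ => ?_)
    rw [gp_kz _ _ (hpos c), ← mul_sub, hdz]
  constructor
  · intro h q hq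
    by_cases hqM : q < M n
    · exact (hrow ⟨q, hqM⟩).1 (h ⟨q, hqM⟩ hq)
    · -- beyond the rows all coordinates vanish
      rw [par]; refine sum_eq_zero fun c _ => ?_
      rw [gp, dif_neg, zero_mul]
      push Not at hqM
      have := Nat.mul_le_mul_right (n + 1) hqM; rw [lK]; omega
  · intro h q hq
    exact (hrow q).2 (h q hq)

/-- The codec equivalence `𝒦 ≃ 𝔽₂^{ℓK}`, `κ ↦ kz κ`. [folklore] -/
def keyEquiv (n : ℕ) : Kv n ≃ KeyZ n where
  toFun κ := kz n κ.toList
  invFun κz := ⟨(zvec (lK n)).enc κz, by rw [(zvec (lK n)).length_enc, zvec_len]⟩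
  left_inv κ := List.Vector.toList_injective ((zvec (lK n)).enc_dec κ.toList (by rw [List.Vector.toList_length, zvec_len]))
  right_inv κz := (zvec (lK n)).dec_enc κz

/-- `keyEquiv κ = kz κ`. [folklore] -/
theorem keyEquiv_apply (κ : Kv n) : keyEquiv n κ = kz n κ.toList := rfl

/-- `(keyEquiv⁻¹ κz).toList = encZ κz`. [folklore] -/
theorem keyEquiv_symm_toList (κz : KeyZ n) : ((keyEquiv n).symm κz).toList = (zvec (lK n)).enc κz := rfl

/-- **The counting identity of the fix-up for the instance.** For `x₀, x ∈ {0,1}ⁿ`, `i`, `δ = f x₀ ⊕ f x` and every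
`g : 𝒦 → ℝ`: `|plantKeys| · Σ_{κ₀} g(fixup κ₀) = |𝒦| · Σ_{κ ∈ plantKeys} g(κ)`, where
`fixup κ₀ = parse (fixupStr n κ₀ δ i)`. [cite: HaitnerEtAl2020, Claim 4.6 ("uniformly subject to …")] -/
theorem card_mul_sum_fixup (hf : IsLengthPreserving f) (x₀ x : Xv n) (i : ℕ) (g : Kv n → ℝ) :
    ((plantKeys (cand n j f).f (cand n j f).hp x₀ x i).card : ℝ) *
        ∑ κ₀ : Kv n, g ((BitCodec.vector (lK n)).dec (fixupStr n κ₀.toList (List.zipWith xor (f x₀.toList) (f x.toList)) i)) =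
      (Fintype.card (Kv n) : ℝ) * ∑ κ ∈ plantKeys (cand n j f).f (cand n j f).hp x₀ x i, g κ := by
  set δ := List.zipWith xor (f x₀.toList) (f x.toList) with hδdef
  have hδ : δ.length = n := by
    rw [hδdef, List.length_zipWith, hf, hf, List.Vector.toList_length, List.Vector.toList_length, min_self]
  set e : Kv n ≃ KeyZ n := keyEquiv n with he
  -- the good set is the image of plantKeys
  set G := Good n (dz n δ) i with hG
  have hPK : (plantKeys (cand n j f).f (cand n j f).hp x₀ x i) = G.map e.symm.toEmbedding := by
    ext κ
    rw [mem_map_equiv, hG, Good, mem_filter, mem_plantKeys_iff_par hf, ← hδdef]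
    simp only [Equiv.symm_symm, mem_univ, true_and, he, keyEquiv_apply]
  by_cases hp : lzStr δ < n
  · -- genuine pivot
    have hpiv : dz n δ ⟨lzStr δ, hp⟩ = 1 := by
      rw [dz]; simp only; rw [getD_lzStr (by rw [hδ]; exact hp), bz_true]
    have key := card_mul_sum_fixHom (i := i) hp hpiv (fun κz => g (e.symm κz))
    -- rewrite the left sum over `Kv`
    have hL : ∑ κ₀ : Kv n, g ((BitCodec.vector (lK n)).dec (fixupStr n κ₀.toList δ i)) =
        ∑ κz : KeyZ n, g (e.symm (fixHom n (dz n δ) i (lzStr δ) κz)) := by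
      rw [← Fintype.sum_equiv e.symm _ _ (fun κz => rfl)]
      refine Fintype.sum_congr _ _ fun κz => ?_
      congr 1
      apply List.Vector.toList_injective
      have hkz : kz n ((zvec (lK n)).enc κz) = κz := (zvec (lK n)).dec_enc κz
      have hlen : ((zvec (lK n)).enc κz).length = lK n := by rw [(zvec (lK n)).length_enc, zvec_len]
      rw [he, keyEquiv_symm_toList, keyEquiv_symm_toList, fixupStr_eq_enc hlen hδ hp, hkz,
        vector_dec_toList _ (by rw [(zvec (lK n)).length_enc, zvec_len])]
    have hR : ∑ κ ∈ plantKeys (cand n j f).f (cand n j f).hp x₀ x i, g κ = ∑ κz ∈ G, g (e.symm κz) := by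
      rw [hPK, sum_map]; rfl
    have hC : ((plantKeys (cand n j f).f (cand n j f).hp x₀ x i).card : ℝ) = G.card := by rw [hPK, card_map]
    have hK : (Fintype.card (Kv n) : ℝ) = Fintype.card (KeyZ n) := by rw [Fintype.card_congr e]
    rw [hL, hR, hC, hK, key]
  · -- no pivot: `δ = 0`, the fix-up is the identity and every key is good
    push Not at hp
    have hz := dz_eq_zero_of_lzStr hδ hp
    have hall : plantKeys (cand n j f).f (cand n j f).hp x₀ x i = univ := by
      rw [hPK, hG, Good]
      have : (univ.filter fun κ : KeyZ n => ∀ q, q < i → par n (dz n δ) q κ = 0) = univ := by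
        rw [filter_eq_self]; intro κ _ q _; rw [hz]; simp [par]
      rw [this, map_univ_equiv]
    rw [hall, card_univ]
    congr 1
    refine Fintype.sum_congr _ _ fun κ₀ => ?_
    congr 1
    apply List.Vector.toList_injective
    rw [fixupStr_eq_self (List.Vector.toList_length κ₀) hδ hp, vector_dec_toList _ (List.Vector.toList_length κ₀)]

end Instance

end HHRVW

end Literature.Computability.Cryptography
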